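import Summits.ValiantsHypothesis.ValiantsHypothesis.Theorems.KPlusLogSqLawStaticPathCount

/-!
# Route «KPlusLogSqLaw» — the static-path `O(n log n)` law, LOCAL form: hypotheses only on the block, from one non-vanishing condition

HONEST FRAMING.  Helper toward the crux `WeakLifting` (item `stmt-ValiantsHypothesis-19561`, route `KPlusLogSqLaw`, cell `pub-symmetroid`,
seat val-sym-lift-p3 g6, 2026-08-27) on the line of its witness-plan stub `stub_tridiagonalSectorB` (tropical twin of the STATIC tridiagonal
sector = parametric max-weight independent set on a path; val-sym-lift-p4 g6 `HOME/val-sym-lift-p4/STATIC-PATH-NLOGN.md`).  The kernel theorem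
`StaticPathFold.exists_cert_opt` (`KPlusLogSqLawStaticPathCount.lean`) carries its non-degeneracy hypotheses for ALL blocks of the infinite item
sequence, which no finitely supported sequence satisfies; THIS FILE proves the APPLICABLE form: the same `66 · n · (⌊log₂ n⌋ + 2)` kink
certificate for the optimum of the block `i+1, …, i+n` under hypotheses on the sub-blocks of THAT block only (`exists_cert_opt_local`), and
derives those from ONE transparent condition — «no alternating interval sum `Σ_{u < t ≤ v} (-1)^t (w₁ t, w₀ t)` with `i ≤ u < v ≤ i + n`
is the zero line» (`exists_cert_opt_of_altSum_ne`; the identities `altA_shift_sub`, `altA_rev_sub` express the prefix-sum lines of every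
sub-block, read from either end, through global alternating interval sums).  Statements about a path DP; nothing here asserts anything about
`WeakLifting`, `TropicalB`, `KPlusLogSqLaw`, the stub in its window, `MatrixDescartes` (stmt-ValiantsHypothesis-18050) or `VP ≠ VNP`.
-/

set_option linter.dupNamespace false
set_option autoImplicit false

namespace Summit.ValiantsHypothesis.ValiantsHypothesis.Theorems.KPlusLogSqLaw

open Finset Classical PiecewiseAffine

namespace StaticPathFold

noncomputable section

variable (w₁ w₀ : ℕ → ℝ)

/-! ## 1. The halving with hypotheses local to the block -/

/-- **halving, local hypotheses**: as `exists_certAll`, but the non-degeneracy is required only for sub-blocks of `i+1, …, i+n`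
(left reading: prefix-sum lines of `shift s` pairwise distinct up to the sub-block length; right reading: the same for `shift 0 (rev j l)`
up to `l`). [folklore] -/
theorem exists_certAll_local (i₀ n₀ : ℕ)
    (hL : ∀ s a p q : ℕ, i₀ ≤ s → s + a ≤ i₀ + n₀ → p < q → q ≤ a →
      (altA (shift s w₁) p ≠ altA (shift s w₁) q ∨ altB (shift s w₀) p ≠ altB (shift s w₀) q))
    (hR : ∀ j l p q : ℕ, i₀ ≤ j → j + l ≤ i₀ + n₀ → p < q → q ≤ l →
      (altA (shift 0 (rev j l w₁)) p ≠ altA (shift 0 (rev j l w₁)) q ∨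
        altB (shift 0 (rev j l w₀)) p ≠ altB (shift 0 (rev j l w₀)) q)) :
    ∀ d n : ℕ, n ≤ 2 ^ d → ∀ i : ℕ, i₀ ≤ i → i + n ≤ i₀ + n₀ → ∃ K : Finset ℝ, K.card ≤ 66 * n * (d + 1) ∧
      (PA (opt w₁ w₀ i n) K ∧ PA (opt w₁ w₀ (i + 1) (n - 1)) K ∧ PA (opt w₁ w₀ i (n - 1)) K ∧ PA (opt w₁ w₀ (i + 1) (n - 2)) K) := by
  -- one junction inside the block: left `s+1..s+a`, right `s+a+1..s+a+b`, with `i₀ ≤ s` and `s + a + b ≤ i₀ + n₀`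
  have junction : ∀ s a b : ℕ, i₀ ≤ s → s + a + b ≤ i₀ + n₀ → 1 ≤ a → 1 ≤ b → ∀ {KL KR : Finset ℝ},
      PA (opt w₁ w₀ s (a - 1)) KL → PA (opt w₁ w₀ s a) KL → PA (opt w₁ w₀ (s + a) b) KR →
      PA (opt w₁ w₀ (s + a + 1) (b - 1)) KR →
      ∃ E : Finset ℝ, E.card ≤ 8 * (a + 1) + 8 * (b + 1) + 1 ∧ PA (opt w₁ w₀ s (a + b)) (KL ∪ KR ∪ E) := by
    intro s a b hs hsab ha hb KL KR h1 h2 h3 h4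
    obtain ⟨a', rfl⟩ : ∃ a', a = a' + 1 := ⟨a - 1, by omega⟩
    obtain ⟨b', rfl⟩ : ∃ b', b = b' + 1 := ⟨b - 1, by omega⟩
    simp only [Nat.add_sub_cancel] at h1 h4
    have hg₁ : PA (fun θ => opt w₁ w₀ s a' θ + opt w₁ w₀ (s + (a' + 1)) (b' + 1) θ) (KL ∪ KR) := h1.add h3
    have hg₂ : PA (fun θ => opt w₁ w₀ s (a' + 1) θ + opt w₁ w₀ (s + (a' + 1) + 1) b' θ) (KL ∪ KR) := h2.add h4
    set B₁ := B (altA (shift s w₁)) (altB (shift s w₀)) (a' + 1) with hB₁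
    set B₂ := B (altA (shift 0 (rev (s + (a' + 1)) (b' + 1) w₁))) (altB (shift 0 (rev (s + (a' + 1)) (b' + 1) w₀))) (b' + 1)
      with hB₂
    have ht₁ : PA (Δ (shift s w₁) (shift s w₀) (a' + 1)) B₁ :=
      pa_train _ _ _ fun p q hpq hq => hL s (a' + 1) p q hs (by omega) hpq hq
    have ht₂ : PA (Δ (shift 0 (rev (s + (a' + 1)) (b' + 1) w₁)) (shift 0 (rev (s + (a' + 1)) (b' + 1) w₀)) (b' + 1)) B₂ :=
      pa_train _ _ _ fun p q hpq hq => hR (s + (a' + 1)) (b' + 1) p q (by omega) (by omega) hpq hq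
    have hdiff : PA (fun θ => (opt w₁ w₀ s a' θ + opt w₁ w₀ (s + (a' + 1)) (b' + 1) θ) -
        (opt w₁ w₀ s (a' + 1) θ + opt w₁ w₀ (s + (a' + 1) + 1) b' θ)) (B₁ ∪ B₂) := by
      refine (ht₁.neg.add ht₂).congr fun θ => ?_
      have e1 := opt_sub_eq_Δ w₁ w₀ s a' θ
      have e2 := opt_sub_first_eq_Δ w₁ w₀ (s + (a' + 1)) b' θ
      show _ = -Δ (shift s w₁) (shift s w₀) (a' + 1) θ +
        Δ (shift 0 (rev (s + (a' + 1)) (b' + 1) w₁)) (shift 0 (rev (s + (a' + 1)) (b' + 1) w₀)) (b' + 1) θ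
      linarith
    have hmax := pa_max hg₁ hg₂ hdiff
    refine ⟨B₁ ∪ B₂ ∪ (finite_crossSet hdiff).toFinset, ?_, ?_⟩
    · have c1 : B₁.card ≤ 4 * (a' + 1 + 1) := card_B_le _ _ _
      have c2 : B₂.card ≤ 4 * (b' + 1 + 1) := card_B_le _ _ _
      have c3 : (finite_crossSet hdiff).toFinset.card ≤ (B₁ ∪ B₂).card + 1 := by
        rw [← Set.ncard_eq_toFinset_card _ (finite_crossSet hdiff)]
        exact ncard_crossSet_le hdiff
      have c4 := Finset.card_union_le B₁ B₂
      calc (B₁ ∪ B₂ ∪ (finite_crossSet hdiff).toFinset).card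
          ≤ (B₁ ∪ B₂).card + (finite_crossSet hdiff).toFinset.card := Finset.card_union_le _ _
        _ ≤ 8 * (a' + 1 + 1) + 8 * (b' + 1 + 1) + 1 := by omega
    · have hj := fun θ => opt_junction w₁ w₀ s (a' + 1) (b' + 1) (by omega) (by omega) θ
      simp only [Nat.add_sub_cancel] at hj
      refine (hmax.congr fun θ => hj θ).mono ?_
      intro x hx
      simp only [Finset.mem_union] at hx ⊢
      tauto
  intro d
  induction d with
  | zero =>
    intro n hn i _ _
    obtain ⟨K, hK, hC⟩ := exists_certAll_le_one w₁ w₀ i n (by simpa using hn)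
    exact ⟨K, by omega, hC⟩
  | succ d ih =>
    intro n hn i hi hin
    by_cases hsmall : n ≤ 2 ^ d
    · obtain ⟨K, hK, hC⟩ := ih n hsmall i hi hin
      exact ⟨K, hK.trans (by nlinarith), hC⟩
    · have hn2 : 2 ≤ n := by
        have : 1 ≤ 2 ^ d := Nat.one_le_two_pow
        omega
      set l₁ := n / 2 with hl₁
      set l₂ := n - l₁ with hl₂
      have hl₁1 : 1 ≤ l₁ := by omega
      have hl₂1 : 1 ≤ l₂ := by omega
      have hl₁d : l₁ ≤ 2 ^ d := by rw [pow_succ] at hn; omega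
      have hl₂d : l₂ ≤ 2 ^ d := by rw [pow_succ] at hn; omega
      have hn12 : l₁ + l₂ = n := by omega
      obtain ⟨KL, hKL, hL1, hL2, hL3, hL4⟩ := ih l₁ hl₁d i hi (by omega)
      obtain ⟨KR, hKR, hR1, hR2, hR3, hR4⟩ := ih l₂ hl₂d (i + l₁) (by omega) (by omega)
      obtain ⟨E₀₀, hE₀₀, hP₀₀⟩ := junction i l₁ l₂ hi (by omega) hl₁1 hl₂1 hL3 hL1 hR1 hR2
      have hV₀₁ : ∃ E : Finset ℝ, E.card ≤ 8 * (l₁ + 1) + 8 * (l₂ + 1) + 1 ∧ PA (opt w₁ w₀ i (n - 1)) (KL ∪ KR ∪ E) := by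
        by_cases h : 1 ≤ l₂ - 1
        · have hR4' : PA (opt w₁ w₀ (i + l₁ + 1) (l₂ - 1 - 1)) KR := by
            have : l₂ - 1 - 1 = l₂ - 2 := by omega
            rw [this]; exact hR4
          obtain ⟨E, hE, hP⟩ := junction i l₁ (l₂ - 1) hi (by omega) hl₁1 h hL3 hL1 hR3 hR4'
          refine ⟨E, by omega, ?_⟩
          have : l₁ + (l₂ - 1) = n - 1 := by omega
          rw [this] at hP; exact hP
        · refine ⟨∅, by rw [Finset.card_empty]; omega, ?_⟩
          have : n - 1 = l₁ := by omega
          rw [this, Finset.union_empty]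
          exact hL1.mono Finset.subset_union_left
      have hV₁₀ : ∃ E : Finset ℝ, E.card ≤ 8 * (l₁ + 1) + 8 * (l₂ + 1) + 1 ∧ PA (opt w₁ w₀ (i + 1) (n - 1)) (KL ∪ KR ∪ E) := by
        by_cases h : 1 ≤ l₁ - 1
        · have hL4' : PA (opt w₁ w₀ (i + 1) (l₁ - 1 - 1)) KL := by
            have : l₁ - 1 - 1 = l₁ - 2 := by omega
            rw [this]; exact hL4
          have hR1' : PA (opt w₁ w₀ (i + 1 + (l₁ - 1)) l₂) KR := by
            have : i + 1 + (l₁ - 1) = i + l₁ := by omega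
            rw [this]; exact hR1
          have hR2' : PA (opt w₁ w₀ (i + 1 + (l₁ - 1) + 1) (l₂ - 1)) KR := by
            have : i + 1 + (l₁ - 1) + 1 = i + l₁ + 1 := by omega
            rw [this]; exact hR2
          obtain ⟨E, hE, hP⟩ := junction (i + 1) (l₁ - 1) l₂ (by omega) (by omega) h hl₂1 hL4' hL2 hR1' hR2'
          refine ⟨E, by omega, ?_⟩
          have : l₁ - 1 + l₂ = n - 1 := by omega
          rw [this] at hP; exact hP
        · refine ⟨∅, by rw [Finset.card_empty]; omega, ?_⟩
          have e1 : n - 1 = l₂ := by omega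
          have e2 : i + 1 = i + l₁ := by omega
          rw [e1, e2, Finset.union_empty]
          exact hR1.mono Finset.subset_union_right
      have hV₁₁ : ∃ E : Finset ℝ, E.card ≤ 8 * (l₁ + 1) + 8 * (l₂ + 1) + 1 ∧ PA (opt w₁ w₀ (i + 1) (n - 2)) (KL ∪ KR ∪ E) := by
        by_cases ha : 1 ≤ l₁ - 1
        · by_cases hb : 1 ≤ l₂ - 1
          · have hL4' : PA (opt w₁ w₀ (i + 1) (l₁ - 1 - 1)) KL := by
              have : l₁ - 1 - 1 = l₁ - 2 := by omega
              rw [this]; exact hL4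
            have hR3' : PA (opt w₁ w₀ (i + 1 + (l₁ - 1)) (l₂ - 1)) KR := by
              have : i + 1 + (l₁ - 1) = i + l₁ := by omega
              rw [this]; exact hR3
            have hR4' : PA (opt w₁ w₀ (i + 1 + (l₁ - 1) + 1) (l₂ - 1 - 1)) KR := by
              have e1 : i + 1 + (l₁ - 1) + 1 = i + l₁ + 1 := by omega
              have e2 : l₂ - 1 - 1 = l₂ - 2 := by omega
              rw [e1, e2]; exact hR4
            obtain ⟨E, hE, hP⟩ := junction (i + 1) (l₁ - 1) (l₂ - 1) (by omega) (by omega) ha hb hL4' hL2 hR3' hR4'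
            refine ⟨E, by omega, ?_⟩
            have : l₁ - 1 + (l₂ - 1) = n - 2 := by omega
            rw [this] at hP; exact hP
          · refine ⟨∅, by rw [Finset.card_empty]; omega, ?_⟩
            have : n - 2 = l₁ - 1 := by omega
            rw [this, Finset.union_empty]
            exact hL2.mono Finset.subset_union_left
        · refine ⟨∅, by rw [Finset.card_empty]; omega, ?_⟩
          have e1 : n - 2 = l₂ - 1 := by omega
          have e2 : i + 1 = i + l₁ := by omega
          rw [e1, e2, Finset.union_empty]
          exact hR3.mono Finset.subset_union_right
      obtain ⟨E₀₁, hE₀₁, hP₀₁⟩ := hV₀₁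
      obtain ⟨E₁₀, hE₁₀, hP₁₀⟩ := hV₁₀
      obtain ⟨E₁₁, hE₁₁, hP₁₁⟩ := hV₁₁
      rw [hn12] at hP₀₀
      refine ⟨KL ∪ KR ∪ (E₀₀ ∪ E₀₁ ∪ E₁₀ ∪ E₁₁), ?_, ?_, ?_, ?_, ?_⟩
      · have c0 := Finset.card_union_le (KL ∪ KR) (E₀₀ ∪ E₀₁ ∪ E₁₀ ∪ E₁₁)
        have c1 := Finset.card_union_le KL KR
        have c2 := Finset.card_union_le (E₀₀ ∪ E₀₁ ∪ E₁₀) E₁₁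
        have c3 := Finset.card_union_le (E₀₀ ∪ E₀₁) E₁₀
        have c4 := Finset.card_union_le E₀₀ E₀₁
        have hbudget : KL.card + KR.card + 4 * (8 * (l₁ + 1) + 8 * (l₂ + 1) + 1) ≤ 66 * n * (d + 1 + 1) := by
          have e1 : KL.card + KR.card ≤ 66 * n * (d + 1) := by
            calc KL.card + KR.card ≤ 66 * l₁ * (d + 1) + 66 * l₂ * (d + 1) := Nat.add_le_add hKL hKR
              _ = 66 * n * (d + 1) := by rw [← hn12]; ring
          nlinarith
        omega
      · exact hP₀₀.mono (by intro x hx; simp only [Finset.mem_union] at hx ⊢; tauto)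
      · exact hP₁₀.mono (by intro x hx; simp only [Finset.mem_union] at hx ⊢; tauto)
      · exact hP₀₁.mono (by intro x hx; simp only [Finset.mem_union] at hx ⊢; tauto)
      · exact hP₁₁.mono (by intro x hx; simp only [Finset.mem_union] at hx ⊢; tauto)

/-- **the `O(n log n)` certificate, local hypotheses.** [folklore] -/
theorem exists_cert_opt_local (i n : ℕ)
    (hL : ∀ s a p q : ℕ, i ≤ s → s + a ≤ i + n → p < q → q ≤ a →
      (altA (shift s w₁) p ≠ altA (shift s w₁) q ∨ altB (shift s w₀) p ≠ altB (shift s w₀) q))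
    (hR : ∀ j l p q : ℕ, i ≤ j → j + l ≤ i + n → p < q → q ≤ l →
      (altA (shift 0 (rev j l w₁)) p ≠ altA (shift 0 (rev j l w₁)) q ∨
        altB (shift 0 (rev j l w₀)) p ≠ altB (shift 0 (rev j l w₀)) q)) :
    ∃ K : Finset ℝ, K.card ≤ 66 * n * (Nat.log 2 n + 2) ∧ PA (opt w₁ w₀ i n) K := by
  have hn : n ≤ 2 ^ (Nat.log 2 n + 1) := (Nat.lt_pow_succ_log_self one_lt_two n).le
  obtain ⟨K, hK, hC⟩ := exists_certAll_local w₁ w₀ i n hL hR (Nat.log 2 n + 1) n hn i le_rfl le_rfl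
  exact ⟨K, hK, hC.1⟩

/-! ## 2. Prefix-sum lines of sub-blocks as global alternating interval sums -/

/-- the prefix-sum slope coefficient of a block read from the left, as a sum. [folklore] -/
theorem altA_shift_eq (w : ℕ → ℝ) (s k : ℕ) :
    altA (shift s w) k = ∑ t ∈ Finset.range k, (-1) ^ (t + 1) * w (s + t + 1) := by
  induction k with
  | zero => simp [altA]
  | succ k ih =>
    rw [Finset.sum_range_succ, ← ih]
    simp only [altA, shift]
    ring_nf

/-- the same for the intercept coefficient (it is the same recursion). [folklore] -/
theorem altB_shift_eq (w : ℕ → ℝ) (s k : ℕ) :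
    altB (shift s w) k = ∑ t ∈ Finset.range k, (-1) ^ (t + 1) * w (s + t + 1) := by
  induction k with
  | zero => simp [altB]
  | succ k ih =>
    rw [Finset.sum_range_succ, ← ih]
    simp only [altB, shift]
    ring_nf

/-- **left reading**: the difference of two prefix-sum coefficients of the block starting after `s` is `±` a global alternating interval sum:
`altA (shift s w) q - altA (shift s w) p = (-1)^s · Σ_{t ∈ (s+p, s+q]} (-1)^t w t`. [folklore] -/
theorem altA_shift_sub (w : ℕ → ℝ) (s p q : ℕ) (hpq : p ≤ q) :
    altA (shift s w) q - altA (shift s w) p = (-1) ^ s * ∑ t ∈ Finset.Ioc (s + p) (s + q), (-1) ^ t * w t := by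
  rw [altA_shift_eq, altA_shift_eq, ← Finset.sum_Ico_eq_sub _ hpq, Finset.mul_sum]
  refine Finset.sum_bij' (fun t _ => s + t + 1) (fun u _ => u - s - 1) ?_ ?_ ?_ ?_ ?_
  · intro t ht; rw [Finset.mem_Ico] at ht; rw [Finset.mem_Ioc]; omega
  · intro u hu; rw [Finset.mem_Ioc] at hu; rw [Finset.mem_Ico]; omega
  · intro t ht; omega
  · intro u hu; rw [Finset.mem_Ioc] at hu; omega
  · intro t ht
    have h : ((-1 : ℝ)) ^ s * ((-1) ^ (s + t + 1) * w (s + t + 1)) = (-1) ^ (t + 1) * w (s + t + 1) := by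
      have : ((-1 : ℝ)) ^ s * (-1) ^ (s + t + 1) = (-1) ^ (t + 1) := by
        rw [← pow_add, show s + (s + t + 1) = 2 * s + (t + 1) by ring, pow_add, pow_mul]; norm_num
      rw [← mul_assoc, this]
    exact h.symm

/-- the same identity for `altB`. [folklore] -/
theorem altB_shift_sub (w : ℕ → ℝ) (s p q : ℕ) (hpq : p ≤ q) :
    altB (shift s w) q - altB (shift s w) p = (-1) ^ s * ∑ t ∈ Finset.Ioc (s + p) (s + q), (-1) ^ t * w t := by
  rw [altB_shift_eq, altB_shift_eq, ← Finset.sum_Ico_eq_sub _ hpq, Finset.mul_sum]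
  refine Finset.sum_bij' (fun t _ => s + t + 1) (fun u _ => u - s - 1) ?_ ?_ ?_ ?_ ?_
  · intro t ht; rw [Finset.mem_Ico] at ht; rw [Finset.mem_Ioc]; omega
  · intro u hu; rw [Finset.mem_Ioc] at hu; rw [Finset.mem_Ico]; omega
  · intro t ht; omega
  · intro u hu; rw [Finset.mem_Ioc] at hu; omega
  · intro t ht
    have h : ((-1 : ℝ)) ^ s * ((-1) ^ (s + t + 1) * w (s + t + 1)) = (-1) ^ (t + 1) * w (s + t + 1) := by
      have : ((-1 : ℝ)) ^ s * (-1) ^ (s + t + 1) = (-1) ^ (t + 1) := by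
        rw [← pow_add, show s + (s + t + 1) = 2 * s + (t + 1) by ring, pow_add, pow_mul]; norm_num
      rw [← mul_assoc, this]
    exact h.symm

/-- **right reading**: for `q ≤ l`, `altA (shift 0 (rev j l w)) q - altA (shift 0 (rev j l w)) p = (-1)^(j+l+1) · Σ_{t ∈ (j+l-q, j+l-p]} (-1)^t w t`. [folklore] -/
theorem altA_rev_sub (w : ℕ → ℝ) (j l p q : ℕ) (hpq : p ≤ q) (hq : q ≤ l) :
    altA (shift 0 (rev j l w)) q - altA (shift 0 (rev j l w)) p =
      (-1) ^ (j + l + 1) * ∑ t ∈ Finset.Ioc (j + l - q) (j + l - p), (-1) ^ t * w t := by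
  rw [altA_shift_eq, altA_shift_eq, ← Finset.sum_Ico_eq_sub _ hpq, Finset.mul_sum]
  refine Finset.sum_bij' (fun t _ => j + l - t) (fun u _ => j + l - u) ?_ ?_ ?_ ?_ ?_
  · intro t ht; rw [Finset.mem_Ico] at ht; rw [Finset.mem_Ioc]; omega
  · intro u hu; rw [Finset.mem_Ioc] at hu; rw [Finset.mem_Ico]; omega
  · intro t ht; rw [Finset.mem_Ico] at ht; omega
  · intro u hu; rw [Finset.mem_Ioc] at hu; omega
  · intro t ht
    rw [Finset.mem_Ico] at ht
    have hidx : j + l + 1 - (0 + t + 1) = j + l - t := by omega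
    simp only [rev]
    rw [hidx]
    have hsgn : ((-1 : ℝ)) ^ (j + l + 1) * (-1) ^ (j + l - t) = (-1) ^ (t + 1) := by
      rw [← pow_add]
      have : j + l + 1 + (j + l - t) = 2 * (j + l - t) + (t + 1) := by omega
      rw [this, pow_add, pow_mul]; norm_num
    rw [← mul_assoc, hsgn]

/-- the same identity for `altB`. [folklore] -/
theorem altB_rev_sub (w : ℕ → ℝ) (j l p q : ℕ) (hpq : p ≤ q) (hq : q ≤ l) :
    altB (shift 0 (rev j l w)) q - altB (shift 0 (rev j l w)) p =
      (-1) ^ (j + l + 1) * ∑ t ∈ Finset.Ioc (j + l - q) (j + l - p), (-1) ^ t * w t := by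
  rw [altB_shift_eq, altB_shift_eq, ← Finset.sum_Ico_eq_sub _ hpq, Finset.mul_sum]
  refine Finset.sum_bij' (fun t _ => j + l - t) (fun u _ => j + l - u) ?_ ?_ ?_ ?_ ?_
  · intro t ht; rw [Finset.mem_Ico] at ht; rw [Finset.mem_Ioc]; omega
  · intro u hu; rw [Finset.mem_Ioc] at hu; rw [Finset.mem_Ico]; omega
  · intro t ht; rw [Finset.mem_Ico] at ht; omega
  · intro u hu; rw [Finset.mem_Ioc] at hu; omega
  · intro t ht
    rw [Finset.mem_Ico] at ht
    have hidx : j + l + 1 - (0 + t + 1) = j + l - t := by omega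
    simp only [rev]
    rw [hidx]
    have hsgn : ((-1 : ℝ)) ^ (j + l + 1) * (-1) ^ (j + l - t) = (-1) ^ (t + 1) := by
      rw [← pow_add]
      have : j + l + 1 + (j + l - t) = 2 * (j + l - t) + (t + 1) := by omega
      rw [this, pow_add, pow_mul]; norm_num
    rw [← mul_assoc, hsgn]

/-! ## 3. The law from one non-vanishing condition -/

/-- **`O(n log n)` KINK CERTIFICATE FROM ONE NON-DEGENERACY CONDITION**: if no alternating interval sum of the item lines inside the block
`i+1, …, i+n` is the zero line — `∀ i ≤ u < v ≤ i+n`, `Σ_{u<t≤v} (-1)^t w₁ t ≠ 0` or `Σ_{u<t≤v} (-1)^t w₀ t ≠ 0` — then the parametric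
maximum-weight independent-set optimum of the block is affine on every closed parameter interval whose interior misses a set of at most
`66 · n · (⌊log₂ n⌋ + 2)` points. [folklore] -/
theorem exists_cert_opt_of_altSum_ne (i n : ℕ)
    (hG : ∀ u v : ℕ, i ≤ u → u < v → v ≤ i + n →
      (∑ t ∈ Finset.Ioc u v, (-1 : ℝ) ^ t * w₁ t ≠ 0 ∨ ∑ t ∈ Finset.Ioc u v, (-1 : ℝ) ^ t * w₀ t ≠ 0)) :
    ∃ K : Finset ℝ, K.card ≤ 66 * n * (Nat.log 2 n + 2) ∧ PA (opt w₁ w₀ i n) K := by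
  refine exists_cert_opt_local w₁ w₀ i n ?_ ?_
  · intro s a p q hs hsa hpq hqa
    have hpow : ((-1 : ℝ)) ^ s ≠ 0 := pow_ne_zero _ (by norm_num)
    rcases hG (s + p) (s + q) (by omega) (by omega) (by omega) with h | h
    · left
      intro he
      have e := altA_shift_sub w₁ s p q hpq.le
      rw [he, sub_self] at e
      exact h ((mul_eq_zero.mp e.symm).resolve_left hpow)
    · right
      intro he
      have e := altB_shift_sub w₀ s p q hpq.le
      rw [he, sub_self] at e
      exact h ((mul_eq_zero.mp e.symm).resolve_left hpow)
  · intro j l p q hj hjl hpq hql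
    have hpow : ((-1 : ℝ)) ^ (j + l + 1) ≠ 0 := pow_ne_zero _ (by norm_num)
    rcases hG (j + l - q) (j + l - p) (by omega) (by omega) (by omega) with h | h
    · left
      intro he
      have e := altA_rev_sub w₁ j l p q hpq.le hql
      rw [he, sub_self] at e
      exact h ((mul_eq_zero.mp e.symm).resolve_left hpow)
    · right
      intro he
      have e := altB_rev_sub w₀ j l p q hpq.le hql
      rw [he, sub_self] at e
      exact h ((mul_eq_zero.mp e.symm).resolve_left hpow)

end

end StaticPathFold

end Summit.ValiantsHypothesis.ValiantsHypothesis.Theorems.KPlusLogSqLaw
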